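import Literature.MathematicalPhysics.QuantumFieldTheory.Balaban1983to89.B9GradLetterTransportedDict
import Literature.MathematicalPhysics.QuantumFieldTheory.Balaban1983to89.B9GradLetterLadderHolonomy

/-!
# `Balaban1983to89.B9GradLetterTransportedInputClasses` — T. Bałaban, *Propagators for lattice gauge theories in a background field*, Commun. Math. Phys. **99** (1985) 389–434
# [Balaban1985BackgroundPropagators], (3.3) p. 391 + (3.40) p. 397 + (3.45) p. 398: THE LETTER `J_μ(U)` OF `D_U = Σ_μ ∇*_{U,μ}∘J_μ` CARRIES THE PRINT-WEIGHTED TRANSPORTED SITE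
# CLASS `bHZP (taxiS U) s` INTO THE PRINT-WEIGHTED TRANSPORTED BOND CLASS `bHZKP (taxiB U) s` — the Hölder-SOURCE kinematic letter of the `hdgDvd13 ∕ hpdgDvd13` road, modulo
# the ladder holonomy of `B9GradLetterLadderHolonomy` (hypothesis `hlad`, supplied there under print's (3.35))

[4] = T. Bałaban, *Propagators and renormalization transformations for lattice gauge theories. II*, Commun. Math. Phys. **96** (1984) 223–250 [`Balaban1984PropagatorsII`].
statement-level skeleton of published theorems with citation tags; proofs where landed; nothing here is a claim about the Yang–Mills mass gap.

THE PRINT.  (3.3) p. 391 (`J_μ`: *"A_μ(x) = A(x, x + ηe_μ)"* read backwards — a site function placed on the bonds of direction `μ` through the link, def-Y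
`Jb U μ Φ ⟨x,μ⟩ = −R(U_μ(x))Φ(x+e_μ)`); (3.40) p. 397 (the transported Hölder quotient over near ∕ admissible pairs along *"a shortest contour"*); (3.45) p. 398 (the Hölder
SOURCE functional `‖λ‖^{ξ′}_ε + |λ|` of `∇_UG(U)∇*_Uλ`); (3.35) p. 396; [4] (2.2) p. 224, (2.51)–(2.54) pp. 232–233, (2.137) p. 247.

WHY THIS FILE (cell `pub-ymgap`, node N06 [B9], seat `pub-ymgap-dag-n06-c` g21; `LOCATED22-ADOPTION-MEMO-g21.md` §3.3 (a); dag-n06-l g32 I.≈31480: the certificate's W-sector class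
slot `bHW13` is FREE, so `hdgDvd13 ∕ hpdgDvd13` leave the display once the W class is the TRANSPORTED site class and THIS letter exists).  `J_μ` multiplies by the link variable,
so only TRANSPORTED Hölder classes are preserved (memo §2); the transported pair term of `J_μλ` at an admissible bond pair `(⟨x,μ⟩, ⟨x′,μ⟩)` is
`−R(U_μ(x))·[X⁺ − R(U_μ(x)⁻¹U(Γ_{x,x′})U_μ(x′))X′⁺]` (`B9GradLetterTransportedDict.trDif_JcoKH`), i.e. the SOURCE's pair term at the shifted sites `(x+e_μ, x′+e_μ)` plus a
transporter discrepancy bounded by the LADDER `‖U(Γ_{x,x′})U_μ(x′)U(Γ_{x+e_μ,x′+e_μ})⁻¹U_μ(x)⁻¹ − 1‖` (`norm_sub_conj_le_ladder`), which print's (3.35) makes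
`≤ Θ·|x−x′|_∞∕L^{j(x′)}` on admissible pairs (`B9GradLetterLadderHolonomy.norm_jLadder_sub_one_le_of_reg335P`, `Θ = (d+1)K_plL⁶`; taken here as the hypothesis `hlad`, so the
file stays over a general normed algebra like B1).  ★★★ `hasMaj_JcoKH_bHZP_bHZKP` — `HasMaj (bHZP (taxiS U) s) (bHZKP (taxiB U) s) (J_μ U) (C_J·e^{δr}·e^{−δd})` with
`C_J = L⁴·c_b·b_b·(3 + 2L² + 2ΘL³)`, `r = 2(r_near + 1) + 2((d+1)(L+1) + 2)`: sup channel — a bond value of `J_μλ` is a link-rotated source value at the shifted site; pair channel —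
source pair at the shifted sites when it is a near pair there (else the sup channel with weight `≤ L²(Lʲ′η)^{−s}`, levels of neighbours differing by ≤ 1), the REVERSED source pair
when only the second shifted site lies in `Δ̃(y′)`, and the ladder term `2Θ·(|x−x′|∕Lʲ′)^{1−s}·(Lʲ′∕Lᵏ)^{−s}·|λ| ≤ 2ΘL³·(Lʲ′η)^{−s}|λ|` — the B1 analysis of
`B9SmoothHolderClassSliceSN` in the other direction with the link factor.  The print-exact ∕ total-family (`bHZPIfam → bHZKPIfam`) re-weighting and the assembler at the pins are
the sequel (D3).

HONEST SCOPE.  Class bookkeeping over landed objects; the ladder bound is a HYPOTHESIS here (discharged by D1a under (3.35)); no estimate of [B9]'s propagators asserted;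
COUNT-NEUTRAL; N06 NOT discharged; nothing continuum, nothing about the mass gap.  A NEW file; 0 `def`, no `sorry`, no `axiom`, no `instance`, no `notation`.
-/

noncomputable section

namespace Literature.MathematicalPhysics.QuantumFieldTheory.Balaban1983to89.B9GradLetterTransportedInputClasses

open B4TorusKernel.MultiPeriod (torusSupNorm torusSupNorm_nonneg)
open B6GlobalChartV1 (PV blkV1 boxEquiv)
open B6Geom246MultiLevelTorus (geomT torusSupNorm_neg)
open B6Ineq2142KLevelV1 (β lvl)
open B6KLevelCensusIndexV1 (KIdx Adm)
open B6MultiLevelTorusOperator (one_le_of_mem)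
open B6Prop22KLevelTorusCensusEta (nKT nKT_pos)
open B9GeoNormsKLevelV1 (geo9K)
open B9GeoLemma21KLevelV1 (geo9K_dist_triangle geo9K_len_pos geo9K_dist_comm)
open B9Thm34Ext (toB6)
open B11SectG (BlockNorm HasMaj)
open B11SectGGlobal (Size)
open B11SectGGlobalSizes
open B11SectGSmoothCutT (Size.ofPairsT ofPairsT_sz_le ofPairsT_term_le)
open B9Eq39Adjoint (R R_def)
open B9Thm39ReadingCoords (coordBound39 basisBound39 abs_repr_le)
open B9CoReadingCoords (assembleK XBK)
open B9CoReadingCoordsS (XSK sIK)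
open B9MultiscaleSmoothPartitionY (scl scl_pos NearY levY_window_of_nearY)
open B9MultiscaleSmoothPartitionYNear (rNear dist_sIK_le_of_nearY)
open B9SmoothHolderClassS (NearPair wEta wEta_nonneg Wscl Wscl_nonneg one_le_Wscl)
open B9SmoothHolderClassK (srcY NearPairK wEtaK wEtaK_nonneg)
open B9SmoothHolderClassT (trDif trDif_apply)
open B9SmoothHolderClassTClosure (len_rpow_neg_eq_Wscl)
open B9SmoothHolderClassP (bHZP bHZP_loc bHZP_isLoc_iff bHZKP bHZKP_loc)
open B9GradViaDivLettersSmoothTerms (blkV1_level_eq_levY)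
open B9GradViaDivLettersTransported (taxiS taxiB)
open B9GradViaDivLettersAtPins (JcoKH)
open B9CoReadingCoordsHolderSNear (NearS)
open B9Eq340ProbeBridgeSNtoKA (supDist_eq_torusSupNorm)
open B9Eq340TaxiTelescope (norm_R_le)
open B9SmoothHolderClassSliceSNDict (levY_window_of_nearS wEta_chartY_eq_wEtaK len_le_of_lvl_le rpow_le_of_le_mul wEtaK_le_of_lt)
open B9GradLetterTransportedDict (norm_le_basisBound39_of_repr_le norm_R_sub_R_le norm_sub_conj_le_ladder supDist_shift_shift nearS_chartY_shift
  levY_chartY_shift_window abs_JcoKH_apply_le trDif_JcoKH trDif_JcoKH_of_ne taxiS_chartY_shift taxiB_mk weight_ratio_le inv_rpow_le_of_le_mul)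
open Node00 (SiteY FBondY IBondY CfgY toKT levY parTaxiV)
open Node00.OpsYNablaBridge (chartY)
open Node00.OpsYSectDCoords (repr_assembleK)
open B9Thm33G0ProbeZeroAtPinsAdm (norm_assembleK_le unitaryLike_parTaxiV)
open T4RelativeLadder (UnitaryLike)
open LatticeFieldCalculus (supDist)

variable {d ℓ : ℕ} {hd : 1 ≤ d + 1} {hL : Odd (ℓ + 1) ∧ 1 < ℓ + 1} {b₀ b₁ : ℝ}
variable {𝔸 : Type} [NormedRing 𝔸] [NormedAlgebra ℂ 𝔸] [CompleteSpace 𝔸]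
variable {κ : Type} [Fintype κ]
variable (i : KIdx d ℓ hd hL b₀ b₁)

/-! ## ★★★ The letter `J_μ` from the site class into the bond class -/

section Main

variable [Fintype (geo9K i).Site] (b : Module.Basis κ ℝ 𝔸) {B : B9.Backgrounds} (cfg : B.Cfg → CfgY 𝔸 i) (U₁ : B.Cfg)
variable {R₀ : ℝ} {H₀ : Prop} {bI : FBondY i → IBondY i}

set_option maxHeartbeats 4000000 in -- ONE B1-size case analysis (sup ∕ pair ∕ reversed-pair ∕ ladder channels) in a single majorant proof
/-- ★★★ **THE HÖLDER-SOURCE LETTER `J_μ` BETWEEN THE TRANSPORTED CLASSES.**  For unitary-like bond variables, a `1`-faithful bond block map `bI`, print's units, `0 < s ≤ 1`, any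
`δ ≥ 0`, and the LADDER hypothesis `hlad` (on admissible pairs `‖U(Γ_{x,x′})U_μ(x′)U(Γ_{x+e_μ,x′+e_μ})⁻¹U_μ(x)⁻¹ − 1‖ ≤ Θ·|x−x′|_∞∕L^{j(x′)}`, `Θ ≥ 0` — print's (3.35), D1a):
`HasMaj (bHZP (taxiS U) s) (bHZKP (taxiB U) s) (J_μ U) (L⁴c_bb_b(3 + 2L² + 2ΘL³)·e^{δr}·e^{−δd(y,y′)})`, `r = 2(r_near+1) + 2((d+1)(L+1)+2)` (module docstring).
[cite: Balaban1985BackgroundPropagators, (3.3) p.391 + (3.40) p.397 + (3.45) p.398 + (3.35) p.396; Balaban1984PropagatorsII, (2.2) p.224, (2.51)–(2.54) pp.232–233, (2.137) p.247] -/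
theorem hasMaj_JcoKH_bHZP_bHZKP [NormOneClass 𝔸] [FiniteDimensional ℝ 𝔸] (hU : ∀ μ' t, UnitaryLike (cfg U₁ μ' t))
    (hβ1 : ∀ f : FBondY i, (geomT i.D).dist (β i.hN i.D i.hk (bI f)) (blkV1 i.hN i.D f) ≤ 1) (hcf : |i.cf| = (nKT (toKT i) : ℝ))
    {s : ℝ} (hs0 : 0 < s) (hs1 : s ≤ 1) {δ : ℝ} (hδ : 0 ≤ δ) (μ : Fin (d + 1)) {Θ : ℝ} (hΘ : 0 ≤ Θ)
    (hlad : ∀ x x' : Site (PV d ℓ i.m i.K hd hL) 0, Adm i ⟨x, μ⟩ ⟨x', μ⟩ →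
      ‖((parTaxiV (cfg U₁) x x' * cfg U₁ μ x' * (parTaxiV (cfg U₁) (x.shift μ) (x'.shift μ))⁻¹ * (cfg U₁ μ x)⁻¹ : 𝔸ˣ) : 𝔸) - 1‖ ≤
        Θ * ((supDist x x' : ℝ) / (((ℓ + 1 : ℕ) : ℝ)) ^ levY i (chartY i x'))) :
    HasMaj (bHZP (κ := κ) i b (taxiS i B cfg U₁) (R := R₀) (H := H₀) hs0.le hs1)
      (bHZKP (κ := κ) i b (taxiB i B cfg U₁) (R := R₀) (H := H₀) hs0.le hs1) (JcoKH i b B cfg μ U₁)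
      (fun y y' => ((((ℓ + 1 : ℕ) : ℝ)) ^ 4 * coordBound39 b * basisBound39 b * (3 + 2 * (((ℓ + 1 : ℕ) : ℝ)) ^ 2 + 2 * Θ * (((ℓ + 1 : ℕ) : ℝ)) ^ 3)) *
        Real.exp (δ * (2 * (rNear d ℓ + 1) + 2 * (((d : ℝ) + 1) * (((ℓ : ℝ) + 1) + 1) + 2))) * Real.exp (-(δ * (geo9K i).dist y y'))) := by
  classical
  haveI : Nonempty (Fin (PV d ℓ i.m i.K hd hL).d) := ⟨⟨0, Nat.succ_pos d⟩⟩
  intro y' lam hA y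
  rw [bHZKP_loc]
  rw [bHZP_isLoc_iff] at hA
  set L : ℝ := ((ℓ + 1 : ℕ) : ℝ) with hLdef
  have hL1 : (1 : ℝ) ≤ L := by rw [hLdef]; exact_mod_cast Nat.succ_le_succ (Nat.zero_le ℓ)
  have hL0 : 0 < L := lt_of_lt_of_le one_pos hL1
  set C₁ : ℝ := ((d : ℝ) + 1) * (((ℓ : ℝ) + 1) + 1) + 2 with hC₁
  have hC₁0 : 0 ≤ C₁ := by positivity
  set rσ : ℝ := 2 * (rNear d ℓ + 1) + 2 * C₁ with hrσ
  set E : ℝ := Real.exp (δ * rσ) * Real.exp (-(δ * (geo9K i).dist y y')) with hE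
  have hE0 : 0 ≤ E := by positivity
  have hE1 : (geo9K i).dist y y' ≤ rσ → 1 ≤ E := by
    intro hd
    rw [hE, ← Real.exp_add, ← Real.exp_zero]
    exact Real.exp_le_exp.2 (by nlinarith)
  have hcb : 0 ≤ coordBound39 b := by unfold coordBound39; exact norm_nonneg _
  have hbb : 0 ≤ basisBound39 b := Finset.sum_nonneg fun _ _ => norm_nonneg _
  have hN : (0 : ℝ) < (nKT (toKT i) : ℝ) := nKT_pos _
  have hR0 : ∀ g : 𝔸ˣ, R g (0 : 𝔸) = 0 := fun g => by rw [R_def, mul_zero, zero_mul]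
  -- THE SOURCE: its two channels and their sizes
  set locS : ℝ := (bHZP (κ := κ) i b (taxiS i B cfg U₁) (R := R₀) (H := H₀) hs0.le hs1).loc y' lam with hlocS
  set SupS : ℝ := (Size.ofSup (toB6 (geo9K i) R₀ H₀) (fun (q : XSK κ i) (y : IBondY i) => NearY i y q.1)).sz y' lam with hSupS
  set PairS : ℝ := (Size.ofPairsT (toB6 (geo9K i) R₀ H₀) (fun (q : XSK κ i) (y : IBondY i) => NearY i y q.1) (NearPair i) (wEta i s) (wEta_nonneg i s)
    (trDif b (taxiS i B cfg U₁))).sz y' lam with hPairS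
  have hSupS0 : 0 ≤ SupS := Size.nonneg _ _ _
  have hPairS0 : 0 ≤ PairS := Size.nonneg _ _ _
  have hlocS_eq : locS = Wscl i (1 - s) y' * (Wscl i s y' * SupS + PairS) := by rw [hlocS, bHZP_loc]
  have hy' : 0 < (geo9K i).len y' := geo9K_len_pos i y'
  have hy : 0 < (geo9K i).len y := geo9K_len_pos i y
  have hW1' : Wscl i (1 - s) y' = (geo9K i).len y' ^ (s - 1) := by rw [← len_rpow_neg_eq_Wscl i hcf, neg_sub]
  have hWs' : Wscl i s y' = (geo9K i).len y' ^ (-s) := by rw [← len_rpow_neg_eq_Wscl i hcf]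
  have hW1 : Wscl i (1 - s) y = (geo9K i).len y ^ (s - 1) := by rw [← len_rpow_neg_eq_Wscl i hcf, neg_sub]
  have hWs : Wscl i s y = (geo9K i).len y ^ (-s) := by rw [← len_rpow_neg_eq_Wscl i hcf]
  have hW1'inv : (Wscl i (1 - s) y')⁻¹ = (geo9K i).len y' ^ (1 - s) := by rw [hW1', ← Real.rpow_neg hy'.le, neg_sub]
  have hW1inv : (Wscl i (1 - s) y)⁻¹ = (geo9K i).len y ^ (1 - s) := by rw [hW1, ← Real.rpow_neg hy.le, neg_sub]
  have hW1'pos : 0 < Wscl i (1 - s) y' := lt_of_lt_of_le zero_lt_one (one_le_Wscl i (by linarith) y')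
  have hWs'0 : 0 ≤ Wscl i s y' := Wscl_nonneg i _ _
  have hlocS0 : 0 ≤ locS := (bHZP (κ := κ) i b (taxiS i B cfg U₁) (R := R₀) (H := H₀) hs0.le hs1).loc_nonneg _ _
  have hSupS_le : SupS ≤ (geo9K i).len y' * locS := by
    have h1 : Wscl i (1 - s) y' * (Wscl i s y' * SupS) ≤ locS := by
      rw [hlocS_eq, mul_add]; exact le_add_of_nonneg_right (mul_nonneg hW1'pos.le hPairS0)
    rw [hW1', hWs', ← mul_assoc, ← Real.rpow_add hy', show s - 1 + -s = (-1 : ℝ) by ring, Real.rpow_neg_one] at h1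
    rwa [inv_mul_le_iff₀ hy'] at h1
  have hPairS_le : PairS ≤ (geo9K i).len y' ^ (1 - s) * locS := by
    have h1 : Wscl i (1 - s) y' * PairS ≤ locS := by
      rw [hlocS_eq, mul_add]; exact le_add_of_nonneg_left (by positivity)
    have h2 : PairS ≤ (Wscl i (1 - s) y')⁻¹ * locS :=
      calc PairS = (Wscl i (1 - s) y')⁻¹ * (Wscl i (1 - s) y' * PairS) := by rw [← mul_assoc, inv_mul_cancel₀ hW1'pos.ne', one_mul]
        _ ≤ (Wscl i (1 - s) y')⁻¹ * locS := mul_le_mul_of_nonneg_left h1 (inv_nonneg.2 hW1'pos.le)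
    rwa [hW1'inv] at h2
  have hlenSup : Wscl i s y' * SupS ≤ (geo9K i).len y' ^ (1 - s) * locS := by
    have h1 : Wscl i (1 - s) y' * (Wscl i s y' * SupS) ≤ locS := by
      rw [hlocS_eq, mul_add]; exact le_add_of_nonneg_right (mul_nonneg hW1'pos.le hPairS0)
    have h2 : Wscl i s y' * SupS ≤ (Wscl i (1 - s) y')⁻¹ * locS :=
      calc Wscl i s y' * SupS = (Wscl i (1 - s) y')⁻¹ * (Wscl i (1 - s) y' * (Wscl i s y' * SupS)) := by
            rw [← mul_assoc, inv_mul_cancel₀ hW1'pos.ne', one_mul]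
        _ ≤ (Wscl i (1 - s) y')⁻¹ * locS := mul_le_mul_of_nonneg_left h1 (inv_nonneg.2 hW1'pos.le)
    rwa [hW1'inv] at h2
  -- the source values and the assembled slices
  have hAq : ∀ q : XSK κ i, |lam q| ≤ SupS := by
    intro q
    by_cases h : NearY i y' q.1
    · exact ofSup_abs_le (g := toB6 (geo9K i) R₀ H₀) (fun (q : XSK κ i) (y : IBondY i) => NearY i y q.1) h lam
    · rw [hA q h, abs_zero]; exact hSupS0
  have hX : ∀ (w : SiteY i) (ν : Fin (d + 1)) (c : κ), ‖assembleK b ν c lam w‖ ≤ basisBound39 b * SupS :=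
    fun w ν c => norm_assembleK_le b ν c lam w fun a => hAq (w, ν, a, c)
  have hX0 : ∀ (w : SiteY i) (ν : Fin (d + 1)) (c : κ), ¬ NearY i y' w → assembleK b ν c lam w = 0 := by
    intro w ν c hw
    unfold assembleK
    exact Finset.sum_eq_zero fun a _ => by rw [hA (w, ν, a, c) hw, zero_smul]
  -- GEOMETRY: the target block `y ∋ chart x`, the source block `y′ ∋` a shifted site
  have hshiftd : ∀ x : Site (PV d ℓ i.m i.K hd hL) 0, (geo9K i).dist (sIK i bI (chartY i x)) (sIK i bI (chartY i (x.shift μ))) ≤ C₁ :=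
    fun x => B9Eq340NearPairBlocks.near_dist_carrier_le i hβ1 (B9Eq340ProbeTransferSNY.nearS_supDist i (nearS_chartY_shift i x μ))
  have hneard : ∀ (a₀ c₀ : κ) {x x' : Site (PV d ℓ i.m i.K hd hL) 0}, Adm i ⟨x, μ⟩ ⟨x', μ⟩ →
      NearS i (chartY i x) (chartY i x') ∧ (geo9K i).dist (sIK i bI (chartY i x)) (sIK i bI (chartY i x')) ≤ C₁ := by
    intro a₀ c₀ x x' hadm
    have hns : NearS i (chartY i x) (chartY i x') := by
      show torusSupNorm (toKT i).NB ((chartY i x).1 - (chartY i x').1) ≤ (((ℓ + 1 : ℕ) : ℝ)) ^ levY i (chartY i x)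
      have h1 : (blkV1 i.hN i.D (⟨x, μ⟩ : FBondY i)).1.1 = levY i (chartY i x) := blkV1_level_eq_levY i ((⟨x, μ⟩ : FBondY i), μ, a₀, c₀)
      rw [← neg_sub, torusSupNorm_neg (fun μ => one_le_of_mem (chartY i x).2 μ), ← supDist_eq_torusSupNorm i x x', ← h1]
      exact_mod_cast hadm.2.1
    exact ⟨hns, B9Eq340NearPairBlocks.near_dist_carrier_le i hβ1 (B9Eq340ProbeTransferSNY.nearS_supDist i hns)⟩
  -- weight comparison of the two blocks: `Lʲ′η ≤ L⁴·E·Lʲη` once the levels are within 4 and the blocks within `rσ`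
  have hcmp : lvl i.hN i.D i.hk y' ≤ lvl i.hN i.D i.hk y + 4 → (geo9K i).dist y y' ≤ rσ →
      (geo9K i).len y' ≤ L ^ 4 * E * (geo9K i).len y ∧ (geo9K i).len y' ^ (1 - s) ≤ L ^ 4 * E * (geo9K i).len y ^ (1 - s) := by
    intro hl hd
    have h1 : (geo9K i).len y' ≤ L ^ 4 * (geo9K i).len y := by rw [hLdef]; exact len_le_of_lvl_le i hcf hl
    have h2 : (geo9K i).len y' ^ (1 - s) ≤ L ^ 4 * (geo9K i).len y ^ (1 - s) := by
      rw [hLdef] at h1 ⊢; exact rpow_le_of_le_mul hy'.le hy.le (by linarith) (by linarith) h1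
    have hE1' := hE1 hd
    have hl4 : 0 ≤ L ^ 4 := by positivity
    constructor
    · calc (geo9K i).len y' ≤ L ^ 4 * (geo9K i).len y := h1
        _ = L ^ 4 * 1 * (geo9K i).len y := by ring
        _ ≤ L ^ 4 * E * (geo9K i).len y := mul_le_mul_of_nonneg_right (mul_le_mul_of_nonneg_left hE1' hl4) hy.le
    · calc (geo9K i).len y' ^ (1 - s) ≤ L ^ 4 * (geo9K i).len y ^ (1 - s) := h2
        _ = L ^ 4 * 1 * (geo9K i).len y ^ (1 - s) := by ring
        _ ≤ L ^ 4 * E * (geo9K i).len y ^ (1 - s) := mul_le_mul_of_nonneg_right (mul_le_mul_of_nonneg_left hE1' hl4) (Real.rpow_nonneg hy.le _)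
  -- THE SUP PART
  set M : ℝ := coordBound39 b * basisBound39 b * (L ^ 4 * E * (geo9K i).len y * locS) with hM
  have hM0 : 0 ≤ M := by positivity
  have hpt : ∀ q : XBK κ i, NearY i y (srcY i q) → |JcoKH i b B cfg μ U₁ lam q| ≤ M := by
    rintro ⟨⟨x, μ''⟩, ν, a, c⟩ hx
    have hx' : NearY i y (chartY i x) := hx
    refine (abs_JcoKH_apply_le i b cfg U₁ hU μ lam ⟨x, μ''⟩ ν a c).trans ?_
    show coordBound39 b * ‖assembleK b ν c lam (chartY i (x.shift μ))‖ ≤ M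
    by_cases hw : NearY i y' (chartY i (x.shift μ))
    · have hl : lvl i.hN i.D i.hk y' ≤ lvl i.hN i.D i.hk y + 4 := by
        have h1 := (levY_window_of_nearY i hx').2
        have h2 := (levY_chartY_shift_window i x μ).2
        have h3 := (levY_window_of_nearY i hw).1
        omega
      have hd : (geo9K i).dist y y' ≤ rσ := by
        have d1 : (geo9K i).dist y (sIK i bI (chartY i x)) ≤ rNear d ℓ + 1 := dist_sIK_le_of_nearY i hβ1 hx'
        have d2 := hshiftd x
        have d3 : (geo9K i).dist (sIK i bI (chartY i (x.shift μ))) y' ≤ rNear d ℓ + 1 := by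
          rw [geo9K_dist_comm]; exact dist_sIK_le_of_nearY i hβ1 hw
        calc (geo9K i).dist y y' ≤ (geo9K i).dist y (sIK i bI (chartY i x)) + (geo9K i).dist (sIK i bI (chartY i x)) y' := geo9K_dist_triangle i _ _ _
          _ ≤ (geo9K i).dist y (sIK i bI (chartY i x)) + ((geo9K i).dist (sIK i bI (chartY i x)) (sIK i bI (chartY i (x.shift μ))) +
                (geo9K i).dist (sIK i bI (chartY i (x.shift μ))) y') := add_le_add le_rfl (geo9K_dist_triangle i _ _ _)
          _ ≤ rσ := by rw [hrσ]; linarith [d1, d2, d3, hC₁0]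
      have h1 := (hcmp hl hd).1
      calc coordBound39 b * ‖assembleK b ν c lam (chartY i (x.shift μ))‖ ≤ coordBound39 b * (basisBound39 b * SupS) := mul_le_mul_of_nonneg_left (hX _ _ _) hcb
        _ ≤ coordBound39 b * (basisBound39 b * ((geo9K i).len y' * locS)) := mul_le_mul_of_nonneg_left (mul_le_mul_of_nonneg_left hSupS_le hbb) hcb
        _ ≤ coordBound39 b * (basisBound39 b * (L ^ 4 * E * (geo9K i).len y * locS)) :=
            mul_le_mul_of_nonneg_left (mul_le_mul_of_nonneg_left (mul_le_mul_of_nonneg_right h1 hlocS0) hbb) hcb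
        _ = M := by rw [hM]; ring
    · rw [hX0 _ _ _ hw, norm_zero, mul_zero]; exact hM0
  have hsupPart : Wscl i (1 - s) y * (Wscl i s y * (Size.ofSup (toB6 (geo9K i) R₀ H₀) (fun (q : XBK κ i) (y : IBondY i) => NearY i y (srcY i q))).sz y
      (JcoKH i b B cfg μ U₁ lam)) ≤ coordBound39 b * basisBound39 b * L ^ 4 * E * locS := by
    have h1 : (Size.ofSup (toB6 (geo9K i) R₀ H₀) (fun (q : XBK κ i) (y : IBondY i) => NearY i y (srcY i q))).sz y (JcoKH i b B cfg μ U₁ lam) ≤ M :=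
      ofSup_sz_le _ hM0 fun q (hq : NearY i y (srcY i q)) => hpt q hq
    have hWW : Wscl i (1 - s) y * Wscl i s y = ((geo9K i).len y)⁻¹ := by
      rw [hW1, hWs, ← Real.rpow_add hy, show s - 1 + -s = (-1 : ℝ) by ring, Real.rpow_neg_one]
    calc Wscl i (1 - s) y * (Wscl i s y * _) = (Wscl i (1 - s) y * Wscl i s y) * _ := by ring
      _ ≤ (Wscl i (1 - s) y * Wscl i s y) * M := mul_le_mul_of_nonneg_left h1 (mul_nonneg (Wscl_nonneg i _ _) (Wscl_nonneg i _ _))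
      _ = (((geo9K i).len y)⁻¹ * (geo9K i).len y) * (coordBound39 b * basisBound39 b * L ^ 4 * E * locS) := by rw [hWW, hM]; ring
      _ = coordBound39 b * basisBound39 b * L ^ 4 * E * locS := by rw [inv_mul_cancel₀ hy.ne', one_mul]
  -- THE PAIR PART
  set Cp : ℝ := coordBound39 b * basisBound39 b * (2 + 2 * L ^ 2 + 2 * Θ * L ^ 3) * L ^ 4 with hCp
  have hCp0 : 0 ≤ Cp := by positivity
  set M₂ : ℝ := Cp * E * (geo9K i).len y ^ (1 - s) * locS with hM₂
  have hM₂0 : 0 ≤ M₂ := by have := Real.rpow_nonneg hy.le (1 - s); positivity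
  have hpair : ∀ q q' : XBK κ i, NearY i y (srcY i q) → NearPairK i q q' →
      wEtaK i s q q' * |trDif b (taxiB i B cfg U₁) q q' (JcoKH i b B cfg μ U₁ lam)| ≤ M₂ := by
    rintro ⟨⟨x, μ''⟩, ν, a, c⟩ ⟨⟨x', μ'''⟩, sl⟩ hx hP
    obtain ⟨hne, hadm, hsl⟩ := hP
    dsimp only at hne hadm hsl hx
    subst hsl
    have hdir : μ'' = μ''' := hadm.1
    subst hdir
    have hx' : NearY i y (chartY i x) := hx
    have hxx : x ≠ x' := fun h => hne (by rw [h])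
    have hw0 : 0 ≤ wEtaK (κ := κ) i s (⟨x, μ''⟩, ν, a, c) (⟨x', μ''⟩, ν, a, c) := wEtaK_nonneg i s _ _
    by_cases hμ : μ = μ''
    swap
    · have hμ' : (⟨x, μ''⟩ : FBondY i).dir ≠ μ := fun h => hμ h.symm
      rw [trDif_JcoKH_of_ne i b cfg U₁ μ lam (x := ⟨x, μ''⟩) (x' := ⟨x', μ''⟩) hμ' hμ', abs_zero, mul_zero]; exact hM₂0
    subst hμ
    -- the pair of direction `μ`: the shifted sites, the transporters, the ladder
    set wP : SiteY i := chartY i (x.shift μ) with hwP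
    set wQ : SiteY i := chartY i (x'.shift μ) with hwQ
    set Xp : 𝔸 := assembleK b ν c lam wP with hXp
    set Xp' : 𝔸 := assembleK b ν c lam wQ with hXp'
    set u : 𝔸ˣ := cfg U₁ μ x with hu
    set u' : 𝔸ˣ := cfg U₁ μ x' with hu'
    set g : 𝔸ˣ := parTaxiV (cfg U₁) x x' with hg
    set gp : 𝔸ˣ := parTaxiV (cfg U₁) (x.shift μ) (x'.shift μ) with hgp
    have huu : UnitaryLike u := hU μ x
    have hgpu : UnitaryLike gp := unitaryLike_parTaxiV hU _ _
    have hhu : UnitaryLike (u⁻¹ * g * u') := (huu.inv.mul (unitaryLike_parTaxiV hU _ _)).mul (hU μ x')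
    -- the transported pair term in coordinates
    have htr : trDif b (taxiB i B cfg U₁) (⟨x, μ⟩, ν, a, c) (⟨x', μ⟩, ν, a, c) (JcoKH i b B cfg μ U₁ lam) =
        b.repr (-R u (Xp - R (u⁻¹ * g * u') Xp')) a := by
      rw [trDif_JcoKH i b cfg U₁ μ lam x x' ν a c, taxiB_mk]
    -- admissibility data: `1 ≤ |x−x′| ≤ L^{j(x′)}`, and `|·|` is the shifted pair's distance
    have hsd' : (supDist x x' : ℝ) ≤ (((ℓ + 1 : ℕ) : ℝ)) ^ levY i (chartY i x') := by
      have h1 : (blkV1 i.hN i.D (⟨x', μ⟩ : FBondY i)).1.1 = levY i (chartY i x') := blkV1_level_eq_levY i ((⟨x', μ⟩ : FBondY i), μ, a, c)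
      rw [← h1]; exact_mod_cast hadm.2.2
    have hsdpos : (0 : ℝ) < (supDist x x' : ℝ) := by
      have h0 : supDist x x' ≠ 0 := fun h => hxx ((B3TorusRadialSums.supDist_eq_zero_iff x x').1 h)
      exact_mod_cast Nat.pos_of_ne_zero h0
    have hsdshift : supDist (x.shift μ) (x'.shift μ) = supDist x x' := supDist_shift_shift x x' μ
    -- the ladder
    have hLad : ‖(gp : 𝔸) - ((u⁻¹ * g * u' : 𝔸ˣ) : 𝔸)‖ ≤ Θ * ((supDist x x' : ℝ) / (((ℓ + 1 : ℕ) : ℝ)) ^ levY i (chartY i x')) :=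
      (norm_sub_conj_le_ladder huu hgpu).trans (hlad x x' hadm)
    -- |trDif| ≤ c_b ‖Xp − R h Xp′‖
    have hD : |trDif b (taxiB i B cfg U₁) (⟨x, μ⟩, ν, a, c) (⟨x', μ⟩, ν, a, c) (JcoKH i b B cfg μ U₁ lam)| ≤
        coordBound39 b * ‖Xp - R (u⁻¹ * g * u') Xp'‖ := by
      rw [htr]
      calc _ ≤ coordBound39 b * ‖-R u (Xp - R (u⁻¹ * g * u') Xp')‖ := abs_repr_le b _ a
        _ ≤ _ := by rw [norm_neg]; exact mul_le_mul_of_nonneg_left (norm_R_le huu _) hcb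
    -- the common end of the non-trivial cases
    have fin : ∀ {t : ℝ}, (NearY i y' wP ∨ NearY i y' wQ) →
        t ≤ coordBound39 b * basisBound39 b * (2 + 2 * L ^ 2 + 2 * Θ * L ^ 3) * ((geo9K i).len y' ^ (1 - s) * locS) → t ≤ M₂ := by
      intro t hor ht
      have hl : lvl i.hN i.D i.hk y' ≤ lvl i.hN i.D i.hk y + 4 := by
        have h1 := (levY_window_of_nearY i hx').2
        have h2 := (levY_window_of_nearS i (hneard a c hadm).1).2
        have h3 := (levY_chartY_shift_window i x μ).2
        have h4 := (levY_chartY_shift_window i x' μ).2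
        rw [← hwP] at h3
        rw [← hwQ] at h4
        rcases hor with h | h
        · have h5 := (levY_window_of_nearY i h).1; omega
        · have h5 := (levY_window_of_nearY i h).1; omega
      have hd : (geo9K i).dist y y' ≤ rσ := by
        have d1 : (geo9K i).dist y (sIK i bI (chartY i x)) ≤ rNear d ℓ + 1 := dist_sIK_le_of_nearY i hβ1 hx'
        have d2 := (hneard a c hadm).2
        have d3 := hshiftd x
        have d4 := hshiftd x'
        have dn := B9GeoNormsKLevelV1.geo9K_dist_nonneg i
        rcases hor with h | h
        · have d5 : (geo9K i).dist (sIK i bI wP) y' ≤ rNear d ℓ + 1 := by rw [geo9K_dist_comm]; exact dist_sIK_le_of_nearY i hβ1 h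
          calc (geo9K i).dist y y' ≤ (geo9K i).dist y (sIK i bI (chartY i x)) + (geo9K i).dist (sIK i bI (chartY i x)) y' := geo9K_dist_triangle i _ _ _
            _ ≤ (geo9K i).dist y (sIK i bI (chartY i x)) + ((geo9K i).dist (sIK i bI (chartY i x)) (sIK i bI wP) + (geo9K i).dist (sIK i bI wP) y') :=
                add_le_add le_rfl (geo9K_dist_triangle i _ _ _)
            _ ≤ rσ := by rw [hrσ]; linarith [d1, d3, d5, hC₁0, dn (sIK i bI (chartY i x)) (sIK i bI (chartY i x'))]
        · have d5 : (geo9K i).dist (sIK i bI wQ) y' ≤ rNear d ℓ + 1 := by rw [geo9K_dist_comm]; exact dist_sIK_le_of_nearY i hβ1 h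
          calc (geo9K i).dist y y' ≤ (geo9K i).dist y (sIK i bI (chartY i x)) + (geo9K i).dist (sIK i bI (chartY i x)) y' := geo9K_dist_triangle i _ _ _
            _ ≤ (geo9K i).dist y (sIK i bI (chartY i x)) + ((geo9K i).dist (sIK i bI (chartY i x)) (sIK i bI (chartY i x')) +
                  (geo9K i).dist (sIK i bI (chartY i x')) y') := add_le_add le_rfl (geo9K_dist_triangle i _ _ _)
            _ ≤ (geo9K i).dist y (sIK i bI (chartY i x)) + ((geo9K i).dist (sIK i bI (chartY i x)) (sIK i bI (chartY i x')) +
                  ((geo9K i).dist (sIK i bI (chartY i x')) (sIK i bI wQ) + (geo9K i).dist (sIK i bI wQ) y')) :=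
                add_le_add le_rfl (add_le_add le_rfl (geo9K_dist_triangle i _ _ _))
            _ ≤ rσ := by rw [hrσ]; linarith [d1, d2, d4, d5, hC₁0, dn (sIK i bI (chartY i x)) (sIK i bI wP)]
      have h2 := (hcmp hl hd).2
      refine ht.trans ?_
      rw [hM₂, hCp]
      have h0 : 0 ≤ coordBound39 b * basisBound39 b * (2 + 2 * L ^ 2 + 2 * Θ * L ^ 3) := by positivity
      calc coordBound39 b * basisBound39 b * (2 + 2 * L ^ 2 + 2 * Θ * L ^ 3) * ((geo9K i).len y' ^ (1 - s) * locS)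
          ≤ coordBound39 b * basisBound39 b * (2 + 2 * L ^ 2 + 2 * Θ * L ^ 3) * ((L ^ 4 * E * (geo9K i).len y ^ (1 - s)) * locS) :=
            mul_le_mul_of_nonneg_left (mul_le_mul_of_nonneg_right h2 hlocS0) h0
        _ = _ := by ring
    -- the weight through the sup channel: `w ≤ L²·(Lʲ′η)^{−s}` when the shifted pair is NOT near at a shifted site of `Δ̃(y′)`
    have hwsup : ∀ {w : SiteY i}, NearY i y' w → (w = wP ∨ w = wQ) →
        ¬ (torusSupNorm (toKT i).NB (wP.1 - wQ.1) ≤ (((ℓ + 1 : ℕ) : ℝ)) ^ levY i w) →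
        wEtaK (κ := κ) i s (⟨x, μ⟩, ν, a, c) (⟨x', μ⟩, ν, a, c) ≤ (((ℓ + 1 : ℕ) : ℝ)) ^ 2 * Wscl i s y' := by
      intro w hw hor hfar
      have hT : torusSupNorm (toKT i).NB (wP.1 - wQ.1) = (supDist x x' : ℝ) := by
        rw [hwP, hwQ, ← neg_sub, torusSupNorm_neg (fun μ => one_le_of_mem (chartY i (x.shift μ)).2 μ), ← supDist_eq_torusSupNorm i, hsdshift]
      rw [hT] at hfar
      have hlt : (ℓ + 1) ^ levY i w < supDist x x' := by exact_mod_cast not_le.1 hfar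
      have hj : lvl i.hN i.D i.hk y' ≤ levY i w + 2 := by have := (levY_window_of_nearY i hw).1; omega
      exact wEtaK_le_of_lt i (κ := κ) hs0.le hs1 (q := ((⟨x, μ⟩ : FBondY i), ν, a, c)) (q' := ((⟨x', μ⟩ : FBondY i), ν, a, c)) hlt hj
    -- the source weight at the shifted sites IS the target weight
    have hwshift : ∀ a' : κ, wEta i s (wP, ν, a', c) (wQ, ν, a', c) = wEtaK (κ := κ) i s (⟨x, μ⟩, ν, a, c) (⟨x', μ⟩, ν, a, c) := by
      intro a'
      rw [hwP, hwQ, wEta_chartY_eq_wEtaK i s (x.shift μ) (x'.shift μ) μ ν ν a' c a' c, wEtaK, wEtaK]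
      dsimp only
      rw [hsdshift]
    have hwshift' : ∀ a' : κ, wEta i s (wQ, ν, a', c) (wP, ν, a', c) = wEtaK (κ := κ) i s (⟨x, μ⟩, ν, a, c) (⟨x', μ⟩, ν, a, c) := by
      intro a'
      rw [hwP, hwQ, wEta_chartY_eq_wEtaK i s (x'.shift μ) (x.shift μ) μ ν ν a' c a' c, wEtaK, wEtaK]
      dsimp only
      rw [supDist_shift_shift, B3TorusRadialSums.supDist_comm]
    -- the ladder term in the class units: `w·(|x−x′|∕L^{j′})·SupS ≤ L³·(Lʲ′η)^{−s}·SupS` when `y′ ∋` a shifted site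
    have hwlad : (NearY i y' wP ∨ NearY i y' wQ) →
        wEtaK (κ := κ) i s (⟨x, μ⟩, ν, a, c) (⟨x', μ⟩, ν, a, c) * ((supDist x x' : ℝ) / (((ℓ + 1 : ℕ) : ℝ)) ^ levY i (chartY i x')) ≤
          L ^ 3 * Wscl i s y' := by
      intro hor
      have hLj : (0 : ℝ) < (((ℓ + 1 : ℕ) : ℝ)) ^ levY i (chartY i x') := pow_pos (by rw [← hLdef]; exact hL0) _
      have h1 : wEtaK (κ := κ) i s (⟨x, μ⟩, ν, a, c) (⟨x', μ⟩, ν, a, c) * ((supDist x x' : ℝ) / (((ℓ + 1 : ℕ) : ℝ)) ^ levY i (chartY i x')) ≤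
          (((((ℓ + 1 : ℕ) : ℝ)) ^ levY i (chartY i x') / (nKT (toKT i) : ℝ)) ^ s)⁻¹ := by
        rw [wEtaK]; dsimp only
        exact weight_ratio_le hsdpos hN hLj hsd' hs1
      -- `scl y′ ≤ L³·L^{j(x′)}` from the level windows
      have hjl : lvl i.hN i.D i.hk y' ≤ levY i (chartY i x') + 3 := by
        have h2 := (levY_window_of_nearS i (hneard a c hadm).1).1
        have h3 := (levY_chartY_shift_window i x μ).2
        have h4 := (levY_chartY_shift_window i x' μ).2
        rw [← hwP] at h3
        rw [← hwQ] at h4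
        rcases hor with h | h
        · have h5 := (levY_window_of_nearY i h).1; omega
        · have h5 := (levY_window_of_nearY i h).1; omega
      have hL1' : (1 : ℝ) ≤ ((ℓ + 1 : ℕ) : ℝ) := by rw [← hLdef]; exact hL1
      have hsclL : scl i y' ≤ L ^ 3 * (((ℓ + 1 : ℕ) : ℝ)) ^ levY i (chartY i x') := by
        rw [scl, hLdef, ← pow_add]
        exact pow_le_pow_right₀ hL1' (by omega)
      have hscl : scl i y' / (nKT (toKT i) : ℝ) ≤ L ^ 3 * ((((ℓ + 1 : ℕ) : ℝ)) ^ levY i (chartY i x') / (nKT (toKT i) : ℝ)) := by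
        rw [← mul_div_assoc]; exact div_le_div_of_nonneg_right hsclL hN.le
      have h2 : (((((ℓ + 1 : ℕ) : ℝ)) ^ levY i (chartY i x') / (nKT (toKT i) : ℝ)) ^ s)⁻¹ ≤ L ^ 3 * Wscl i s y' := by
        rw [Wscl]
        exact inv_rpow_le_of_le_mul (div_pos (scl_pos i y') hN) (div_pos hLj hN) (one_le_pow₀ hL1) hscl hs0.le hs1
      exact h1.trans h2
    by_cases h1 : NearY i y' wP
    · -- the first shifted site lies in Δ̃(y′): source pair or sup channel, plus the ladder term
      have hXp'n : ‖Xp'‖ ≤ basisBound39 b * SupS := hX _ _ _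
      -- ‖Xp − R h Xp′‖ ≤ ‖Xp − R g⁺ Xp′‖ + 2‖g⁺ − h‖‖Xp′‖
      have hsplit : ‖Xp - R (u⁻¹ * g * u') Xp'‖ ≤ ‖Xp - R gp Xp'‖ + 2 * ‖(gp : 𝔸) - ((u⁻¹ * g * u' : 𝔸ˣ) : 𝔸)‖ * ‖Xp'‖ := by
        have e : Xp - R (u⁻¹ * g * u') Xp' = (Xp - R gp Xp') + (R gp Xp' - R (u⁻¹ * g * u') Xp') := by abel
        rw [e]
        exact (norm_add_le _ _).trans (add_le_add le_rfl (norm_R_sub_R_le hgpu hhu Xp'))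
      -- the ladder piece in the class units
      have hladder : wEtaK (κ := κ) i s (⟨x, μ⟩, ν, a, c) (⟨x', μ⟩, ν, a, c) * (2 * ‖(gp : 𝔸) - ((u⁻¹ * g * u' : 𝔸ˣ) : 𝔸)‖ * ‖Xp'‖) ≤
          2 * Θ * L ^ 3 * basisBound39 b * ((geo9K i).len y' ^ (1 - s) * locS) := by
        calc _ ≤ wEtaK (κ := κ) i s (⟨x, μ⟩, ν, a, c) (⟨x', μ⟩, ν, a, c) *
              (2 * (Θ * ((supDist x x' : ℝ) / (((ℓ + 1 : ℕ) : ℝ)) ^ levY i (chartY i x'))) * (basisBound39 b * SupS)) := by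
              refine mul_le_mul_of_nonneg_left ?_ hw0
              exact mul_le_mul (mul_le_mul_of_nonneg_left hLad (by norm_num)) hXp'n (norm_nonneg _) (by positivity)
          _ = 2 * Θ * basisBound39 b * ((wEtaK (κ := κ) i s (⟨x, μ⟩, ν, a, c) (⟨x', μ⟩, ν, a, c) *
              ((supDist x x' : ℝ) / (((ℓ + 1 : ℕ) : ℝ)) ^ levY i (chartY i x'))) * SupS) := by ring
          _ ≤ 2 * Θ * basisBound39 b * ((L ^ 3 * Wscl i s y') * SupS) :=
              mul_le_mul_of_nonneg_left (mul_le_mul_of_nonneg_right (hwlad (Or.inl h1)) hSupS0) (by positivity)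
          _ = 2 * Θ * L ^ 3 * basisBound39 b * (Wscl i s y' * SupS) := by ring
          _ ≤ 2 * Θ * L ^ 3 * basisBound39 b * ((geo9K i).len y' ^ (1 - s) * locS) := mul_le_mul_of_nonneg_left hlenSup (by positivity)
      by_cases hns : torusSupNorm (toKT i).NB (wP.1 - wQ.1) ≤ (((ℓ + 1 : ℕ) : ℝ)) ^ levY i wP
      · -- the shifted pair is a SOURCE pair: each coordinate of `Xp − R g⁺ Xp′` is a source pair term
        have hneP : wP.1 ≠ wQ.1 := by
          intro h
          have : wP = wQ := Subtype.ext h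
          rw [hwP, hwQ] at this
          exact hxx (by
            have h2 := (chartY i).injective this
            have h3 := congrArg (fun z : Site (PV d ℓ i.m i.K hd hL) 0 => z.unshift μ) h2
            simpa [B10StarCount.unshift_shift] using h3)
        have hP : ∀ a' : κ, NearPair i (wP, ν, a', c) (wQ, ν, a', c) := fun a' => ⟨hneP, hns, rfl⟩
        have hcoord : ∀ a' : κ, wEtaK (κ := κ) i s (⟨x, μ⟩, ν, a, c) (⟨x', μ⟩, ν, a, c) * |b.repr (Xp - R gp Xp') a'| ≤ PairS := by
          intro a'
          have ht := ofPairsT_term_le (g := toB6 (geo9K i) R₀ H₀) (mem := fun (q : XSK κ i) (y : IBondY i) => NearY i y q.1) (P := NearPair i) (w := wEta i s)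
            (hw := wEta_nonneg i s) (Δ := trDif b (taxiS i B cfg U₁)) (y := y') (z := (wP, ν, a', c)) (z' := (wQ, ν, a', c)) h1 (hP a') lam
          rw [trDif_apply, hwshift a'] at ht
          dsimp only at ht
          rw [hwP, hwQ, taxiS_chartY_shift] at ht
          rw [hXp, hXp', hgp, hwP, hwQ]
          exact ht
        have hD1 : wEtaK (κ := κ) i s (⟨x, μ⟩, ν, a, c) (⟨x', μ⟩, ν, a, c) * ‖Xp - R gp Xp'‖ ≤ basisBound39 b * PairS := by
          by_cases hwz : wEtaK (κ := κ) i s (⟨x, μ⟩, ν, a, c) (⟨x', μ⟩, ν, a, c) = 0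
          · rw [hwz, zero_mul]; positivity
          have hwpos : 0 < wEtaK (κ := κ) i s (⟨x, μ⟩, ν, a, c) (⟨x', μ⟩, ν, a, c) := lt_of_le_of_ne hw0 (Ne.symm hwz)
          have hc' : ∀ a' : κ, |b.repr (Xp - R gp Xp') a'| ≤ PairS / wEtaK (κ := κ) i s (⟨x, μ⟩, ν, a, c) (⟨x', μ⟩, ν, a, c) := by
            intro a'; rw [le_div_iff₀ hwpos, mul_comm]; exact hcoord a'
          have hn := norm_le_basisBound39_of_repr_le b _ hc'
          calc _ ≤ wEtaK (κ := κ) i s (⟨x, μ⟩, ν, a, c) (⟨x', μ⟩, ν, a, c) * (basisBound39 b * (PairS / wEtaK (κ := κ) i s (⟨x, μ⟩, ν, a, c) (⟨x', μ⟩, ν, a, c))) :=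
                mul_le_mul_of_nonneg_left hn hw0
            _ = basisBound39 b * PairS := by field_simp
        refine fin (Or.inl h1) ?_
        calc _ ≤ wEtaK (κ := κ) i s (⟨x, μ⟩, ν, a, c) (⟨x', μ⟩, ν, a, c) * (coordBound39 b * ‖Xp - R (u⁻¹ * g * u') Xp'‖) :=
              mul_le_mul_of_nonneg_left hD hw0
          _ ≤ wEtaK (κ := κ) i s (⟨x, μ⟩, ν, a, c) (⟨x', μ⟩, ν, a, c) *
              (coordBound39 b * (‖Xp - R gp Xp'‖ + 2 * ‖(gp : 𝔸) - ((u⁻¹ * g * u' : 𝔸ˣ) : 𝔸)‖ * ‖Xp'‖)) :=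
              mul_le_mul_of_nonneg_left (mul_le_mul_of_nonneg_left hsplit hcb) hw0
          _ = coordBound39 b * (wEtaK (κ := κ) i s (⟨x, μ⟩, ν, a, c) (⟨x', μ⟩, ν, a, c) * ‖Xp - R gp Xp'‖ +
              wEtaK (κ := κ) i s (⟨x, μ⟩, ν, a, c) (⟨x', μ⟩, ν, a, c) * (2 * ‖(gp : 𝔸) - ((u⁻¹ * g * u' : 𝔸ˣ) : 𝔸)‖ * ‖Xp'‖)) := by ring
          _ ≤ coordBound39 b * (basisBound39 b * PairS + 2 * Θ * L ^ 3 * basisBound39 b * ((geo9K i).len y' ^ (1 - s) * locS)) :=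
              mul_le_mul_of_nonneg_left (add_le_add hD1 hladder) hcb
          _ ≤ coordBound39 b * (basisBound39 b * ((geo9K i).len y' ^ (1 - s) * locS) + 2 * Θ * L ^ 3 * basisBound39 b * ((geo9K i).len y' ^ (1 - s) * locS)) :=
              mul_le_mul_of_nonneg_left (add_le_add (mul_le_mul_of_nonneg_left hPairS_le hbb) le_rfl) hcb
          _ ≤ _ := by
              have h0 : 0 ≤ (geo9K i).len y' ^ (1 - s) * locS := by have := Real.rpow_nonneg hy'.le (1 - s); positivity
              have hcc : 0 ≤ coordBound39 b * basisBound39 b := mul_nonneg hcb hbb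
              nlinarith [mul_nonneg hcc h0, mul_nonneg (mul_nonneg hcc h0) (pow_nonneg hL0.le 2)]
      · -- the shifted pair is NOT near at `wP`: the sup channel for `Xp − R g⁺ Xp′`
        have hwle := hwsup h1 (Or.inl rfl) hns
        have hD1 : ‖Xp - R gp Xp'‖ ≤ 2 * (basisBound39 b * SupS) :=
          calc ‖Xp - R gp Xp'‖ ≤ ‖Xp‖ + ‖R gp Xp'‖ := norm_sub_le _ _
            _ ≤ basisBound39 b * SupS + basisBound39 b * SupS := add_le_add (hX _ _ _) ((norm_R_le hgpu _).trans hXp'n)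
            _ = _ := by ring
        refine fin (Or.inl h1) ?_
        calc _ ≤ wEtaK (κ := κ) i s (⟨x, μ⟩, ν, a, c) (⟨x', μ⟩, ν, a, c) * (coordBound39 b * ‖Xp - R (u⁻¹ * g * u') Xp'‖) :=
              mul_le_mul_of_nonneg_left hD hw0
          _ ≤ wEtaK (κ := κ) i s (⟨x, μ⟩, ν, a, c) (⟨x', μ⟩, ν, a, c) *
              (coordBound39 b * (‖Xp - R gp Xp'‖ + 2 * ‖(gp : 𝔸) - ((u⁻¹ * g * u' : 𝔸ˣ) : 𝔸)‖ * ‖Xp'‖)) :=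
              mul_le_mul_of_nonneg_left (mul_le_mul_of_nonneg_left hsplit hcb) hw0
          _ = coordBound39 b * (wEtaK (κ := κ) i s (⟨x, μ⟩, ν, a, c) (⟨x', μ⟩, ν, a, c) * ‖Xp - R gp Xp'‖ +
              wEtaK (κ := κ) i s (⟨x, μ⟩, ν, a, c) (⟨x', μ⟩, ν, a, c) * (2 * ‖(gp : 𝔸) - ((u⁻¹ * g * u' : 𝔸ˣ) : 𝔸)‖ * ‖Xp'‖)) := by ring
          _ ≤ coordBound39 b * (((((ℓ + 1 : ℕ) : ℝ)) ^ 2 * Wscl i s y') * (2 * (basisBound39 b * SupS)) +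
              2 * Θ * L ^ 3 * basisBound39 b * ((geo9K i).len y' ^ (1 - s) * locS)) :=
              mul_le_mul_of_nonneg_left (add_le_add (mul_le_mul hwle hD1 (norm_nonneg _) (by positivity)) hladder) hcb
          _ = coordBound39 b * (2 * L ^ 2 * basisBound39 b * (Wscl i s y' * SupS) + 2 * Θ * L ^ 3 * basisBound39 b * ((geo9K i).len y' ^ (1 - s) * locS)) := by
              rw [hLdef]; ring
          _ ≤ coordBound39 b * (2 * L ^ 2 * basisBound39 b * ((geo9K i).len y' ^ (1 - s) * locS) + 2 * Θ * L ^ 3 * basisBound39 b * ((geo9K i).len y' ^ (1 - s) * locS)) :=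
              mul_le_mul_of_nonneg_left (add_le_add (mul_le_mul_of_nonneg_left hlenSup (by positivity)) le_rfl) hcb
          _ ≤ _ := by
              have h0 : 0 ≤ (geo9K i).len y' ^ (1 - s) * locS := by have := Real.rpow_nonneg hy'.le (1 - s); positivity
              have hcc : 0 ≤ coordBound39 b * basisBound39 b := mul_nonneg hcb hbb
              nlinarith [mul_nonneg hcc h0]
    · by_cases h2 : NearY i y' wQ
      · -- only the second shifted site lies in Δ̃(y′): `Xp = 0`, `‖D‖ ≤ ‖Xp′‖`
        have hXp0 : Xp = 0 := hX0 _ _ _ h1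
        have hDle : ‖Xp - R (u⁻¹ * g * u') Xp'‖ ≤ ‖Xp'‖ := by rw [hXp0, zero_sub, norm_neg]; exact norm_R_le hhu _
        by_cases hns : torusSupNorm (toKT i).NB (wQ.1 - wP.1) ≤ (((ℓ + 1 : ℕ) : ℝ)) ^ levY i wQ
        · -- the REVERSED shifted pair is a source pair with first point in Δ̃(y′): every coordinate of `Xp′`
          have hneP : wQ.1 ≠ wP.1 := by
            intro h
            have : wQ = wP := Subtype.ext h
            rw [hwP, hwQ] at this
            exact hxx (by
              have h2' := (chartY i).injective this
              have h3 := congrArg (fun z : Site (PV d ℓ i.m i.K hd hL) 0 => z.unshift μ) h2'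
              simpa [B10StarCount.unshift_shift] using h3.symm)
          have hP' : ∀ a' : κ, NearPair i (wQ, ν, a', c) (wP, ν, a', c) := fun a' => ⟨hneP, hns, rfl⟩
          have hcoord : ∀ a' : κ, wEtaK (κ := κ) i s (⟨x, μ⟩, ν, a, c) (⟨x', μ⟩, ν, a, c) * |lam (wQ, ν, a', c)| ≤ PairS := by
            intro a'
            have ht := ofPairsT_term_le (g := toB6 (geo9K i) R₀ H₀) (mem := fun (q : XSK κ i) (y : IBondY i) => NearY i y q.1) (P := NearPair i) (w := wEta i s)
              (hw := wEta_nonneg i s) (Δ := trDif b (taxiS i B cfg U₁)) (y := y') (z := (wQ, ν, a', c)) (z' := (wP, ν, a', c)) h2 (hP' a') lam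
            rw [trDif_apply, hwshift' a'] at ht
            dsimp only at ht
            rw [show assembleK b ν c lam wP = 0 from hXp0, hR0, sub_zero, repr_assembleK] at ht
            exact ht
          have hD2 : wEtaK (κ := κ) i s (⟨x, μ⟩, ν, a, c) (⟨x', μ⟩, ν, a, c) * ‖Xp'‖ ≤ basisBound39 b * PairS := by
            by_cases hwz : wEtaK (κ := κ) i s (⟨x, μ⟩, ν, a, c) (⟨x', μ⟩, ν, a, c) = 0
            · rw [hwz, zero_mul]; positivity
            have hwpos : 0 < wEtaK (κ := κ) i s (⟨x, μ⟩, ν, a, c) (⟨x', μ⟩, ν, a, c) := lt_of_le_of_ne hw0 (Ne.symm hwz)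
            have hc' : ∀ a' : κ, |lam (wQ, ν, a', c)| ≤ PairS / wEtaK (κ := κ) i s (⟨x, μ⟩, ν, a, c) (⟨x', μ⟩, ν, a, c) := by
              intro a'; rw [le_div_iff₀ hwpos, mul_comm]; exact hcoord a'
            have hn : ‖Xp'‖ ≤ basisBound39 b * (PairS / wEtaK (κ := κ) i s (⟨x, μ⟩, ν, a, c) (⟨x', μ⟩, ν, a, c)) := norm_assembleK_le b ν c lam wQ hc'
            calc _ ≤ wEtaK (κ := κ) i s (⟨x, μ⟩, ν, a, c) (⟨x', μ⟩, ν, a, c) * (basisBound39 b * (PairS / wEtaK (κ := κ) i s (⟨x, μ⟩, ν, a, c) (⟨x', μ⟩, ν, a, c))) :=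
                  mul_le_mul_of_nonneg_left hn hw0
              _ = basisBound39 b * PairS := by field_simp
          refine fin (Or.inr h2) ?_
          calc _ ≤ wEtaK (κ := κ) i s (⟨x, μ⟩, ν, a, c) (⟨x', μ⟩, ν, a, c) * (coordBound39 b * ‖Xp'‖) :=
                mul_le_mul_of_nonneg_left (hD.trans (mul_le_mul_of_nonneg_left hDle hcb)) hw0
            _ = coordBound39 b * (wEtaK (κ := κ) i s (⟨x, μ⟩, ν, a, c) (⟨x', μ⟩, ν, a, c) * ‖Xp'‖) := by ring
            _ ≤ coordBound39 b * (basisBound39 b * PairS) := mul_le_mul_of_nonneg_left hD2 hcb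
            _ ≤ coordBound39 b * (basisBound39 b * ((geo9K i).len y' ^ (1 - s) * locS)) := mul_le_mul_of_nonneg_left (mul_le_mul_of_nonneg_left hPairS_le hbb) hcb
            _ ≤ _ := by
                have h0 : 0 ≤ (geo9K i).len y' ^ (1 - s) * locS := by have := Real.rpow_nonneg hy'.le (1 - s); positivity
                have hcc : 0 ≤ coordBound39 b * basisBound39 b := mul_nonneg hcb hbb
                nlinarith [mul_nonneg hcc h0, mul_nonneg (mul_nonneg hcc h0) (pow_nonneg hL0.le 2), mul_nonneg (mul_nonneg (mul_nonneg hcc h0) (pow_nonneg hL0.le 3)) hΘ]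
        · -- not near at `wP′` either: the sup channel for `Xp′`
          have hwle := hwsup h2 (Or.inr rfl) (by
            intro h; apply hns
            rwa [← neg_sub, torusSupNorm_neg (fun μ => one_le_of_mem wQ.2 μ)] at h)
          refine fin (Or.inr h2) ?_
          calc _ ≤ wEtaK (κ := κ) i s (⟨x, μ⟩, ν, a, c) (⟨x', μ⟩, ν, a, c) * (coordBound39 b * ‖Xp'‖) :=
                mul_le_mul_of_nonneg_left (hD.trans (mul_le_mul_of_nonneg_left hDle hcb)) hw0
            _ ≤ ((((ℓ + 1 : ℕ) : ℝ)) ^ 2 * Wscl i s y') * (coordBound39 b * (basisBound39 b * SupS)) :=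
                mul_le_mul hwle (mul_le_mul_of_nonneg_left (hX _ _ _) hcb) (by positivity) (by positivity)
            _ = coordBound39 b * basisBound39 b * L ^ 2 * (Wscl i s y' * SupS) := by rw [hLdef]; ring
            _ ≤ coordBound39 b * basisBound39 b * L ^ 2 * ((geo9K i).len y' ^ (1 - s) * locS) := mul_le_mul_of_nonneg_left hlenSup (by positivity)
            _ ≤ _ := by
                have h0 : 0 ≤ (geo9K i).len y' ^ (1 - s) * locS := by have := Real.rpow_nonneg hy'.le (1 - s); positivity
                have hcc : 0 ≤ coordBound39 b * basisBound39 b := mul_nonneg hcb hbb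
                nlinarith [mul_nonneg hcc h0, mul_nonneg (mul_nonneg hcc h0) (pow_nonneg hL0.le 2), mul_nonneg (mul_nonneg (mul_nonneg hcc h0) (pow_nonneg hL0.le 3)) hΘ]
      · -- neither shifted site lies in Δ̃(y′): the term vanishes
        have hXp0 : Xp = 0 := hX0 _ _ _ h1
        have hXp'0 : Xp' = 0 := hX0 _ _ _ h2
        rw [htr, hXp0, hXp'0, hR0, sub_zero, hR0, neg_zero, map_zero, Finsupp.zero_apply, abs_zero, mul_zero]
        exact hM₂0
  have hpairPart : Wscl i (1 - s) y * (Size.ofPairsT (toB6 (geo9K i) R₀ H₀) (fun (q : XBK κ i) (y : IBondY i) => NearY i y (srcY i q)) (NearPairK i) (wEtaK i s)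
        (wEtaK_nonneg i s) (trDif b (taxiB i B cfg U₁))).sz y (JcoKH i b B cfg μ U₁ lam) ≤ Cp * E * locS := by
    have h1 : (Size.ofPairsT (toB6 (geo9K i) R₀ H₀) (fun (q : XBK κ i) (y : IBondY i) => NearY i y (srcY i q)) (NearPairK i) (wEtaK i s) (wEtaK_nonneg i s)
        (trDif b (taxiB i B cfg U₁))).sz y (JcoKH i b B cfg μ U₁ lam) ≤ M₂ :=
      ofPairsT_sz_le _ _ _ _ _ hM₂0 fun q q' (hq : NearY i y (srcY i q)) (hqq : NearPairK i q q') => hpair q q' hq hqq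
    calc Wscl i (1 - s) y * _ ≤ Wscl i (1 - s) y * M₂ := mul_le_mul_of_nonneg_left h1 (Wscl_nonneg i _ _)
      _ = (Wscl i (1 - s) y * (geo9K i).len y ^ (1 - s)) * (Cp * E * locS) := by rw [hM₂]; ring
      _ = Cp * E * locS := by rw [← hW1inv, mul_inv_cancel₀ (ne_of_gt (lt_of_lt_of_le zero_lt_one (one_le_Wscl i (by linarith) y))), one_mul]
  -- assemble
  rw [mul_add]
  refine le_trans (add_le_add hsupPart hpairPart) (le_of_eq ?_)
  rw [hE, hCp, hrσ, hC₁]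
  ring

end Main

end Literature.MathematicalPhysics.QuantumFieldTheory.Balaban1983to89.B9GradLetterTransportedInputClasses

end
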